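import Mathlib
import HarnessLib
import Literature.Analysis.FluidPDE.TaoAveragedSingleScaleAt
import Literature.Analysis.FluidPDE.TaoAveragedCascadeHolds
import Summits.NavierStokesRegularity.NavierStokesRegularity.Theses.TaoLadderRungOne

/-!
# Route TaoLadderRungOne — BC5 rung for the crux `SingleScaleNoDilAt` (item stmt-NavierStokesRegularity-20473):
# its inner sentence AT Tao's normalisation `xi0`, for every κ

HONEST FRAMING: MODEL statement (Tao 2016's single-scale identity (3.9) for his local cascade class);
nothing here concerns the true Navier–Stokes equations.

`SingleScaleNoDilAt` (v2) quantifies over all closed base triangles with sides in `[4/5, 3/2]` and input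
gap `≥ κ ε₀`. Tao's `xi0 = ((0,1,0), (−1,−1,0), (1,0,0))` has moduli `(1, √2, 1)` — inside the window
(`xi0_window`) — and there the sentence is the tree's named fact `singleScale_isComplexAverageNoDil`
(§3.5–§3.9, PROVED: `singleScale_isComplexAverageNoDil_holds`), read through the `Iff.rfl`-level
dictionary `singleScaleAt_isComplexAverageNoDil_xi0_iff`. This is the item's witness of weakness (BC5):
the one triangle where the (3.24) margin is absolute; the crux's content is uniformity down to gap ≍ κε₀.
[cite: Tao2016AveragedNS, §3.5–3.9 (3.9)]
-/

-- the sub-problem namespace `Summit.NavierStokesRegularity.NavierStokesRegularity` repeats the summit name by design (D-0017)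
set_option linter.dupNamespace false

namespace Summit.NavierStokesRegularity.NavierStokesRegularity.Theorems

open Literature.Analysis.FluidPDE.Tao2016

/-- **`SingleScaleNoDilAt` at `ξ = xi0`, every `κ`** (BC5 rung; tree fact §3.5–3.9 at Tao's
normalisation). [cite: Tao2016AveragedNS, §3.5–3.9 (3.9)] -/
theorem taoLadderRungOne_singleScaleNoDilAt_rung_xi0 :
    ∀ κ : ℝ, 0 < κ → ∃ ε₁ : ℝ, 0 < ε₁ ∧ ∀ ε₀ : ℝ, 0 < ε₀ → ε₀ ≤ ε₁ →
    xi0 0 + xi0 1 + xi0 2 = 0 → (∀ j, 4 / 5 ≤ ‖xi0 j‖ ∧ ‖xi0 j‖ ≤ 3 / 2) →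
    κ * ε₀ ≤ |‖xi0 0‖ - ‖xi0 1‖| →
    ∀ ψ : Fin 3 → SchwartzMap (EuclideanSpace ℝ (Fin 3)) (EuclideanSpace ℂ (Fin 3)),
      NormalisedProfilesAt xi0 ε₀ ψ →
      IsComplexAverageNoDilOf (singleScaleForm (ψ 0) (ψ 1) (ψ 2)) (betaRhoZeroFormAt xi0 ε₀) := by
  intro κ _
  obtain ⟨ε₁, hε₁, H⟩ := singleScaleAt_isComplexAverageNoDil_xi0_iff.mpr
    singleScale_isComplexAverageNoDil_holds
  exact ⟨ε₁, hε₁, fun ε₀ hε₀ hle _ _ _ ψ hψ => H ε₀ hε₀ hle ψ hψ⟩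

/-- **`xi0` lies in the v2 window `[4/5, 3/2]`** (moduli `1, √2, 1`), so the rung is a genuine instance
of the crux's `∀ ξ`-sentence (and `xi0_sum` closes the triangle). [cite: Tao2016AveragedNS, §3.2 (3.7)] -/
theorem taoLadderRungOne_xi0_window : ∀ j, 4 / 5 ≤ ‖xi0 j‖ ∧ ‖xi0 j‖ ≤ 3 / 2 := by
  have h0 : ‖xi0 0‖ = 1 := by
    simp [xi0, EuclideanSpace.norm_eq, Fin.sum_univ_three]
  have h1 : ‖xi0 1‖ = Real.sqrt 2 := by
    simp [xi0, EuclideanSpace.norm_eq, Fin.sum_univ_three]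
    norm_num
  have h2 : ‖xi0 2‖ = 1 := by
    simp [xi0, EuclideanSpace.norm_eq, Fin.sum_univ_three]
  have hs1 : (1 : ℝ) ≤ Real.sqrt 2 := Real.one_le_sqrt.mpr (by norm_num)
  have hs2 : Real.sqrt 2 ≤ 3 / 2 := by
    rw [show (3 / 2 : ℝ) = Real.sqrt ((3 / 2) ^ 2) by rw [Real.sqrt_sq (by norm_num)]]
    exact Real.sqrt_le_sqrt (by norm_num)
  intro j
  fin_cases j
  · simp only [Fin.zero_eta, h0]; norm_num
  · simp only [Fin.mk_one, h1]; constructor <;> linarith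
  · simp only [Fin.reduceFinMk, h2]; norm_num

/-- The rung packaged as «the `ξ = xi0` slice of `SingleScaleNoDilAt` holds with all its hypotheses
discharged»: for every `κ > 0` there is `ε₁ > 0` such that for `0 < ε₀ ≤ ε₁` every profile triple
normalised at `xi0` gives a dilation-free complex average — closure and window supplied by `xi0_sum`,
`taoLadderRungOne_xi0_window`. [cite: Tao2016AveragedNS, §3.5–3.9 (3.9)] -/
theorem taoLadderRungOne_singleScaleNoDilAt_slice_xi0 (κ : ℝ) (_hκ : 0 < κ) :
    ∃ ε₁ : ℝ, 0 < ε₁ ∧ ∀ ε₀ : ℝ, 0 < ε₀ → ε₀ ≤ ε₁ →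
    ∀ ψ : Fin 3 → SchwartzMap (EuclideanSpace ℝ (Fin 3)) (EuclideanSpace ℂ (Fin 3)),
      NormalisedProfilesAt xi0 ε₀ ψ →
      IsComplexAverageNoDilOf (singleScaleForm (ψ 0) (ψ 1) (ψ 2)) (betaRhoZeroFormAt xi0 ε₀) :=
  singleScaleAt_isComplexAverageNoDil_xi0_iff.mpr singleScale_isComplexAverageNoDil_holds

/-- **The input-modulus gap AT `xi0`**: `|‖xi0 0‖ − ‖xi0 1‖| = √2 − 1`, so the crux's gap hypothesis
`κ ε₀ ≤ |‖ξ 0‖ − ‖ξ 1‖|` HOLDS at `ξ = xi0` for every `κ > 0` once `ε₀ ≤ (√2 − 1)/κ` (referee c22 R1: the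
rung must not merely ignore the gap hypothesis — it is satisfiable, hence the instance is genuine). -/
theorem taoLadderRungOne_xi0_gap {κ ε₀ : ℝ} (hκ : 0 < κ) (hε : ε₀ ≤ (Real.sqrt 2 - 1) / κ) :
    κ * ε₀ ≤ |‖xi0 0‖ - ‖xi0 1‖| := by
  have h0 : ‖xi0 0‖ = 1 := by
    simp [xi0, EuclideanSpace.norm_eq, Fin.sum_univ_three]
  have h1 : ‖xi0 1‖ = Real.sqrt 2 := by
    simp [xi0, EuclideanSpace.norm_eq, Fin.sum_univ_three]
    norm_num
  have hs1 : (1 : ℝ) ≤ Real.sqrt 2 := Real.one_le_sqrt.mpr (by norm_num)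
  rw [h0, h1, abs_sub_comm, abs_of_nonneg (by linarith)]
  calc κ * ε₀ ≤ κ * ((Real.sqrt 2 - 1) / κ) := by
        exact mul_le_mul_of_nonneg_left hε hκ.le
    _ = Real.sqrt 2 - 1 := by field_simp

/-- **The genuine `xi0`-instance of `SingleScaleNoDilAt` (BC5 rung, all three hypotheses DISCHARGED,
referee c22 R1)**: for every `κ > 0` there is `ε₁ > 0` (the tree's §3.5–3.9 threshold, capped by
`(√2 − 1)/κ`) such that for `0 < ε₀ ≤ ε₁` the base triple `xi0` satisfies the crux's closure, window
and gap hypotheses AND every profile triple normalised at `xi0` yields a dilation-free complex average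
of `B_{η,ρ,0;xi0}`. [cite: Tao2016AveragedNS, §3.2 (3.7), §3.5–3.9 (3.9)] -/
theorem taoLadderRungOne_singleScaleNoDilAt_instance_xi0 (κ : ℝ) (hκ : 0 < κ) :
    ∃ ε₁ : ℝ, 0 < ε₁ ∧ ∀ ε₀ : ℝ, 0 < ε₀ → ε₀ ≤ ε₁ →
      (xi0 0 + xi0 1 + xi0 2 = 0 ∧ (∀ j, 4 / 5 ≤ ‖xi0 j‖ ∧ ‖xi0 j‖ ≤ 3 / 2) ∧
        κ * ε₀ ≤ |‖xi0 0‖ - ‖xi0 1‖|) ∧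
      ∀ ψ : Fin 3 → SchwartzMap (EuclideanSpace ℝ (Fin 3)) (EuclideanSpace ℂ (Fin 3)),
        NormalisedProfilesAt xi0 ε₀ ψ →
        IsComplexAverageNoDilOf (singleScaleForm (ψ 0) (ψ 1) (ψ 2)) (betaRhoZeroFormAt xi0 ε₀) := by
  obtain ⟨ε₁, hε₁, H⟩ := singleScaleAt_isComplexAverageNoDil_xi0_iff.mpr
    singleScale_isComplexAverageNoDil_holds
  have hs : 0 < (Real.sqrt 2 - 1) / κ := by
    have : (1 : ℝ) < Real.sqrt 2 := by
      rw [show (1 : ℝ) = Real.sqrt 1 by simp]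
      exact Real.sqrt_lt_sqrt (by norm_num) (by norm_num)
    exact div_pos (by linarith) hκ
  refine ⟨min ε₁ ((Real.sqrt 2 - 1) / κ), lt_min hε₁ hs, fun ε₀ hε₀ hle => ⟨⟨xi0_sum,
    taoLadderRungOne_xi0_window, taoLadderRungOne_xi0_gap hκ (hle.trans (min_le_right _ _))⟩,
    fun ψ hψ => H ε₀ hε₀ (hle.trans (min_le_left _ _)) ψ hψ⟩⟩

end Summit.NavierStokesRegularity.NavierStokesRegularity.Theorems
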